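import Literature.MathematicalPhysics.KineticTheory.HardSphereDuhamelNullSets
import Literature.MathematicalPhysics.KineticTheory.HardSphereBBGKYRegularity
import HarnessLib

/-!
# The transported adjunctions of the hard-sphere hierarchy are non-singular: proof of the
# pull-back hypotheses of `HardSphereDuhamelNullSets`, hence of the corrected input (R)
(Bodineau–Gallagher–Saint-Raymond, Invent. Math. 203 (2016) = arXiv:1305.3397v2, §3.1 Remark 3.1
p. 9 and §5.1 p. 15 ("`Ψ_{i+1}` is well defined up to a set of measure 0 [Simonella 2014]");
Cercignani–Illner–Pulvirenti 1994 App. 4.A; trunk T-KINETIC, topic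
MathematicalPhysics/KineticTheory; the dynamics half of the corrected input (R) of
`bgsr_linearBoltzmannApprox_of_domainInputs` (`TaggedSphereLinearBoltzmannInputs`).)

`HardSphereDuhamelNullSets` proves that the Duhamel terms of the hard-sphere hierarchy respect
Lebesgue-null sets on domain-supported families (`HierarchyModel.RespectsAEOn`) GIVEN the
predicates `GainPullback ε` and `LossPullback ε`: the maps
`((u, Z'), (ω, v)) ↦ Φ^{s+1}_{-u}(outRep_i (adj Z' i ω v))` (`adj` the gain, resp. loss,
configuration; `Φ` the regularised Alexander flow) are quasi-measure-preserving from
`du dZ' dσ dv` restricted to `{u > 0, ±ω·(v - v_i) > 0, adjoined configuration in D_ε}` to Lebesgue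
measure. This file PROVES both predicates for `d ≥ 2`, `0 < ε < 1/2`, with the flux engine
`ae_lossConfig_of_persistent` of `HardSphereOutgoingGood` and the tools of
`HardSphereBBGKYRegularity`:

* §1 `ae_ae_not_badTimes` — for a Lebesgue-null `A ⊆ Config k`, almost every configuration `W`
  spends a null set of backward times in `A` (for each `u` the set `Φ_{-u}⁻¹ A` is null, the
  regularised flow preserving Lebesgue measure; Fubini);
* §2 `ae_lossConfig_goodAvoids` — the flux engine run with the persistent property
  "good, and a null set of backward times in `A`" (persistence: along a collision-free free
  flight the flow is the free flight, `flow_eq_freeFlight_of_freeFlight_ne`, and the set of bad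
  times is translated): for a.e. `Z'`, a.e. `w` and `σ`-a.e. outgoing `ν`, the adjoined
  configuration `lossConfig Z' i ν w`, if in the domain, is good and its backward orbit meets `A`
  only at a null set of times;
* §3 `gainPullback` — **`GainPullback ε` holds** (`outRep ∘ gainConfig = lossConfig`,
  `outRep_gainConfig_torus`; the null set of parameters is split into those violating §2 — null by
  Fubini — and the rest, whose time sections are null);
* §4 `lossPullback` — **`LossPullback ε` holds**: the loss adjunction is the gain adjunction at
  the scattered parameters (`outRep_lossConfig_torus`, `gainConfig_eq_lossConfig_scatterParams`),
  and the scattering preserves the parameter measure (`measurePreserving_scatterSkew`);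
* §5 `hsHierarchyModel_respectsAEOn` — **the corrected input (R)**: for `d ≥ 2`, `0 < ε < 1/2`
  and every `N`, `(hsHierarchyModel hε hε' N).RespectsAEOn (fun _ => volume) (fun k => D_ε^k)`
  (`hs_respectsAEOn_of_pullback`); `hsHierarchyModel_respectsAEOn_all` is binder for binder the
  hypothesis `hRob` of `bgsr_linearBoltzmannApprox_of_domainInputs`.

## References

* T. Bodineau, I. Gallagher, L. Saint-Raymond, *The Brownian motion as the limit of a
  deterministic system of hard-spheres*, Invent. Math. 203 (2016) 493–553 = arXiv:1305.3397v2,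
  §3.1 Remark 3.1 p. 9; §5.1 p. 15.
* S. Simonella, *Evolution of correlation functions in the hard sphere dynamics*, J. Stat. Phys.
  155 (2014) 1191–1221, §3.
* C. Cercignani, R. Illner, M. Pulvirenti, *The Mathematical Theory of Dilute Gases*, Springer
  (1994), App. 4.A pp. 107–111.
-/

open MeasureTheory MeasureTheory.Measure Metric Real Set Filter Function
open scoped InnerProductSpace ENNReal
open Literature.Analysis.FluidPDE (Config configEnergy GCState Geometry hardSphereDomain lossConfig gainConfig
  freeFlight)

namespace Literature.MathematicalPhysics.KineticTheory

noncomputable section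

set_option synthInstance.maxSize 1024

section Kinetic

variable {d : Type*} [Fintype d]

attribute [local instance] sigmaFinite_volume_phaseSpace

variable {ε : ℝ} (hε : 0 < ε) (hε' : ε < 2⁻¹)

/-! ## §1. Almost every configuration spends a null set of backward times in a null set -/

include hε' in
/-- The set of (configuration, backward time) pairs whose transported configuration lies in `A`,
`{(W, u) | u > 0, Φ_{-u} W ∈ A}`, is measurable. [folklore] -/
theorem measurableSet_badTimes {k : ℕ} {A : Set (Config k d (UnitAddTorus d))} (hA : MeasurableSet A) :
    MeasurableSet {p : Config k d (UnitAddTorus d) × ℝ | 0 < p.2 ∧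
      Literature.Analysis.FluidPDE.Alexander.regFlow (Literature.Analysis.FluidPDE.Torus.geometry d) ε (-p.2) p.1 ∈ A} := by
  have h2 : Measurable fun p : Config k d (UnitAddTorus d) × ℝ => ((-p.2, p.1) : ℝ × Config k d (UnitAddTorus d)) :=
    measurable_snd.neg.prodMk measurable_fst
  have hm : Measurable fun p : Config k d (UnitAddTorus d) × ℝ =>
      Literature.Analysis.FluidPDE.Alexander.regFlow (Literature.Analysis.FluidPDE.Torus.geometry d) ε (-p.2) p.1 := by
    -- (elaborate the composition without expected type: the direct term times out)
    have h := (Literature.Analysis.FluidPDE.Alexander.measurable_regFlow_uncurry (d := d) (N := k) hε').comp h2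
    exact h
  exact (measurableSet_lt measurable_const measurable_snd).inter (hm hA)

include hε hε' in
/-- **Almost every configuration spends a null set of backward times in a Lebesgue-null set**:
if `A ⊆ Config k` is null then for a.e. `W`, for a.e. `u`, NOT (`u > 0` and `Φ_{-u} W ∈ A`)
(for each `u` the set `Φ_{-u}⁻¹ A` is null since the regularised flow preserves Lebesgue measure,
`Alexander.measurePreserving_regFlow_volume`; then Fubini, `Measure.ae_ae_comm`). [folklore] -/
theorem ae_ae_not_badTimes {k : ℕ} {A : Set (Config k d (UnitAddTorus d))} (hA : MeasurableSet A)
    (hA0 : volume A = 0) :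
    ∀ᵐ W : Config k d (UnitAddTorus d), ∀ᵐ u : ℝ, ¬ (0 < u ∧
      Literature.Analysis.FluidPDE.Alexander.regFlow (Literature.Analysis.FluidPDE.Torus.geometry d) ε (-u) W ∈ A) := by
  have hS := measurableSet_badTimes (ε := ε) hε' hA
  have hu : ∀ u : ℝ, ∀ᵐ W : Config k d (UnitAddTorus d), ¬ (0 < u ∧
      Literature.Analysis.FluidPDE.Alexander.regFlow (Literature.Analysis.FluidPDE.Torus.geometry d) ε (-u) W ∈ A) := by
    intro u
    have h := (Literature.Analysis.FluidPDE.Alexander.measurePreserving_regFlow_volume (d := d) (N := k) hε hε'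
      (-u)).quasiMeasurePreserving.ae (measure_eq_zero_iff_ae_notMem.1 hA0)
    filter_upwards [h] with W hW
    exact fun hc => hW hc.2
  have hall : ∀ᵐ u : ℝ, ∀ᵐ W : Config k d (UnitAddTorus d), ¬ (0 < u ∧
      Literature.Analysis.FluidPDE.Alexander.regFlow (Literature.Analysis.FluidPDE.Torus.geometry d) ε (-u) W ∈ A) :=
    ae_of_all _ hu
  have hS' : MeasurableSet {p : ℝ × Config k d (UnitAddTorus d) | ¬ (0 < p.1 ∧
      Literature.Analysis.FluidPDE.Alexander.regFlow (Literature.Analysis.FluidPDE.Torus.geometry d) ε (-p.1) p.2 ∈ A)} :=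
    (hS.preimage (measurable_snd.prodMk measurable_fst)).compl
  exact (Measure.ae_ae_comm (μ := (volume : Measure ℝ)) (ν := (volume : Measure (Config k d (UnitAddTorus d))))
    hS').1 hall

include hε hε' in
/-- The set of configurations which are good and spend a null set of backward times in `A` is
measurable (`measurableSet_setOf_ae_mem`). [folklore] -/
theorem measurableSet_goodAvoids {k : ℕ} {A : Set (Config k d (UnitAddTorus d))} (hA : MeasurableSet A) :
    MeasurableSet {W : Config k d (UnitAddTorus d) |
      W ∈ Literature.Analysis.FluidPDE.Alexander.good (N := k) (Literature.Analysis.FluidPDE.Torus.geometry d) ε ∧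
      ∀ᵐ u : ℝ, ¬ (0 < u ∧
        Literature.Analysis.FluidPDE.Alexander.regFlow (Literature.Analysis.FluidPDE.Torus.geometry d) ε (-u) W ∈ A)} := by
  have hgood : MeasurableSet (Literature.Analysis.FluidPDE.Alexander.good (N := k)
      (Literature.Analysis.FluidPDE.Torus.geometry d) ε) :=
    (Literature.Analysis.FluidPDE.Alexander.regHardSphereFlow (d := d) hε hε' k).measurableSet_good
  have hS := measurableSet_badTimes (ε := ε) hε' hA
  have h2 := measurableSet_setOf_ae_mem (volume : Measure ℝ) hS.compl
  exact hgood.inter h2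

/-! ## §2. The flux engine: adjoined configurations are good and avoid a null set in time -/

include hε hε' in
/-- **Flux-almost every outgoing adjoined configuration of the domain is good and spends a null
set of backward times in a given Lebesgue-null set** `A ⊆ Config (s+1)` (`d ≥ 2`,
`0 < ε < 1/2`): `ae_lossConfig_of_persistent` (`HardSphereOutgoingGood`) with the property
"good, and `{u > 0 | Φ_{-u} W ∈ A}` null", which persists into the Lebesgue-null set
`D_ε ∩ (goodᶜ ∪ {W | {u > 0 | Φ_{-u} W ∈ A} not null})` (`ae_ae_not_badTimes`): along a
collision-free free flight of length `τ` the flow is the free flight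
(`HardSphereFlow.flow_eq_freeFlight_of_freeFlight_ne`, `Alexander.mem_good_of_freeFlight_mem_good`),
so the bad backward times of `S_τ W₀` contain the translates by `τ` of those of `W₀`.
[cite: BodineauGallagherSaintRaymondInvent2016, §5.1 p. 15] -/
theorem ae_lossConfig_goodAvoids (hd : 2 ≤ Fintype.card d) {s : ℕ} (i : Fin s)
    {A : Set (Config (s + 1) d (UnitAddTorus d))} (hA : MeasurableSet A) (hA0 : volume A = 0) :
    ∀ᵐ Z' : Config s d (UnitAddTorus d), ∀ᵐ w : EuclideanSpace ℝ d,
      ∀ᵐ ν : sphere (0 : EuclideanSpace ℝ d) 1 ∂(volume : Measure (EuclideanSpace ℝ d)).toSphere,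
        0 < ⟪w - (Z' i).2, (ν : EuclideanSpace ℝ d)⟫_ℝ →
        lossConfig (Literature.Analysis.FluidPDE.Torus.geometry d) ε Z' i ν w ∈
          hardSphereDomain (Literature.Analysis.FluidPDE.Torus.geometry d) (s + 1) ε →
        (lossConfig (Literature.Analysis.FluidPDE.Torus.geometry d) ε Z' i ν w ∈
            Literature.Analysis.FluidPDE.Alexander.good (N := s + 1) (Literature.Analysis.FluidPDE.Torus.geometry d) ε ∧
          ∀ᵐ u : ℝ, ¬ (0 < u ∧
            Literature.Analysis.FluidPDE.Alexander.regFlow (Literature.Analysis.FluidPDE.Torus.geometry d) ε (-u)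
              (lossConfig (Literature.Analysis.FluidPDE.Torus.geometry d) ε Z' i ν w) ∈ A)) := by
  classical
  set good := Literature.Analysis.FluidPDE.Alexander.good (N := s + 1) (Literature.Analysis.FluidPDE.Torus.geometry d) ε with hgood_def
  have hgood : MeasurableSet good :=
    (Literature.Analysis.FluidPDE.Alexander.regHardSphereFlow (d := d) hε hε' (s + 1)).measurableSet_good
  have hD : MeasurableSet (hardSphereDomain (Literature.Analysis.FluidPDE.Torus.geometry d) (s + 1) ε) := measurableSet_hardSphereDomain_torus (s + 1) ε
  -- the persistent property and its null failure set
  set P : Config (s + 1) d (UnitAddTorus d) → Prop := fun W => W ∈ good ∧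
    ∀ᵐ u : ℝ, ¬ (0 < u ∧ Literature.Analysis.FluidPDE.Alexander.regFlow (Literature.Analysis.FluidPDE.Torus.geometry d) ε (-u) W ∈ A) with hP
  set T : Set (Config (s + 1) d (UnitAddTorus d)) := hardSphereDomain (Literature.Analysis.FluidPDE.Torus.geometry d) (s + 1) ε ∩
    (goodᶜ ∪ {W | ¬ ∀ᵐ u : ℝ, ¬ (0 < u ∧ Literature.Analysis.FluidPDE.Alexander.regFlow (Literature.Analysis.FluidPDE.Torus.geometry d) ε (-u) W ∈ A)})
    with hT
  have hBm : MeasurableSet {W : Config (s + 1) d (UnitAddTorus d) |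
      ¬ ∀ᵐ u : ℝ, ¬ (0 < u ∧ Literature.Analysis.FluidPDE.Alexander.regFlow (Literature.Analysis.FluidPDE.Torus.geometry d) ε (-u) W ∈ A)} :=
    (measurableSet_setOf_ae_mem (volume : Measure ℝ) (measurableSet_badTimes (ε := ε) hε' hA).compl).compl
  have hTm : MeasurableSet T := hD.inter (hgood.compl.union hBm)
  have hT0 : volume T = 0 := by
    have h1 : volume (hardSphereDomain (Literature.Analysis.FluidPDE.Torus.geometry d) (s + 1) ε ∩ goodᶜ) = 0 := by
      have h : Literature.Analysis.FluidPDE.liouville (Literature.Analysis.FluidPDE.Torus.geometry d) (s + 1) ε goodᶜ = 0 :=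
        Literature.Analysis.FluidPDE.Alexander.torusFlow_ae_good_holds (d := d) hε hε' (s + 1)
      rw [Literature.Analysis.FluidPDE.liouville, Measure.restrict_apply hgood.compl] at h
      rwa [inter_comm] at h
    have h2 : volume {W : Config (s + 1) d (UnitAddTorus d) |
        ¬ ∀ᵐ u : ℝ, ¬ (0 < u ∧ Literature.Analysis.FluidPDE.Alexander.regFlow (Literature.Analysis.FluidPDE.Torus.geometry d) ε (-u) W ∈ A)} = 0 :=
      ae_iff.1 (ae_ae_not_badTimes hε hε' hA hA0)
    refine measure_mono_null (fun W hW => ?_) (measure_union_null h1 h2)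
    rcases hW.2 with hW2 | hW2
    · exact Or.inl ⟨hW.1, hW2⟩
    · exact Or.inr hW2
  -- persistence
  have hpers : ∀ (W₀ : Config (s + 1) d (UnitAddTorus d)) (τ : ℝ), 0 < τ → τ ≤ 1 →
      (∀ u ∈ Ioc 0 τ, ∀ j k : Fin (s + 1), j ≠ k →
        ε < ‖(Literature.Analysis.FluidPDE.Torus.geometry d).sepVec (freeFlight (Literature.Analysis.FluidPDE.Torus.geometry d) u W₀ j).1 (freeFlight (Literature.Analysis.FluidPDE.Torus.geometry d) u W₀ k).1‖) →
      ¬ P W₀ → freeFlight (Literature.Analysis.FluidPDE.Torus.geometry d) τ W₀ ∈ T := by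
    intro W₀ τ hτ0 _ hwin hnot
    refine ⟨fun j k hjk => (hwin τ ⟨hτ0, le_rfl⟩ j k hjk).le, ?_⟩
    by_contra hc
    simp only [mem_union, mem_compl_iff, mem_setOf_eq, not_or, not_not] at hc
    obtain ⟨hgoodτ, havoid⟩ := hc
    apply hnot
    have hsep : ∀ u ∈ Ioc 0 τ, ∀ j k : Fin (s + 1), j ≠ k →
        ‖(Literature.Analysis.FluidPDE.Torus.geometry d).sepVec (freeFlight (Literature.Analysis.FluidPDE.Torus.geometry d) u W₀ j).1 (freeFlight (Literature.Analysis.FluidPDE.Torus.geometry d) u W₀ k).1‖ ≠ ε :=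
      fun u hu j k hjk => (hwin u hu j k hjk).ne'
    have hW₀ : W₀ ∈ good :=
      Literature.Analysis.FluidPDE.Alexander.mem_good_of_freeFlight_mem_good hε hε' hτ0.le hsep hgoodτ
    refine ⟨hW₀, ?_⟩
    -- on the collision-free stretch the flow is the free flight
    set Φ := Literature.Analysis.FluidPDE.Alexander.regHardSphereFlow (d := d) hε hε' (s + 1) with hΦ
    have hflow : Literature.Analysis.FluidPDE.Alexander.regFlow (Literature.Analysis.FluidPDE.Torus.geometry d) ε τ W₀ = freeFlight (Literature.Analysis.FluidPDE.Torus.geometry d) τ W₀ := by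
      have := Φ.flow_eq_freeFlight_of_freeFlight_ne Literature.Analysis.FluidPDE.Torus.continuous_geometry_translate
        (z := W₀) hW₀ hsep τ ⟨hτ0.le, le_rfl⟩
      simpa [hΦ] using this
    -- translate the bad times
    have h1 : ∀ᵐ u : ℝ, ¬ (0 < u + τ ∧
        Literature.Analysis.FluidPDE.Alexander.regFlow (Literature.Analysis.FluidPDE.Torus.geometry d) ε (-(u + τ)) (freeFlight (Literature.Analysis.FluidPDE.Torus.geometry d) τ W₀) ∈ A) :=
      (measurePreserving_add_right (volume : Measure ℝ) τ).quasiMeasurePreserving.ae havoid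
    filter_upwards [h1] with u hu hc
    apply hu
    refine ⟨by linarith [hc.1], ?_⟩
    rw [← hflow, ← Literature.Analysis.FluidPDE.Alexander.regFlow_add hε hε', show -(u + τ) + τ = -u by ring]
    exact hc.2
  exact Literature.Analysis.FluidPDE.ae_lossConfig_of_persistent (d := d) hd hε hε' i hTm hT0 P hpers

/-! ## §3. `GainPullback` holds -/

include hε hε' in
/-- **The transported gain adjunctions pull Lebesgue-null sets back to null sets**
(`GainPullback ε`, `d ≥ 2`, `0 < ε < 1/2`). For a null `A`, the parameters
`((u, Z'), (ω, v))` with `u > 0`, `ω·(v - v_i) > 0`, adjoined configuration in the domain and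
`Φ_{-u}(outRep (gainConfig Z' i ω v)) = Φ_{-u}(lossConfig Z' i ω v) ∈ A` either violate the
flux-a.e. property of `ae_lossConfig_goodAvoids` (a null set of `(Z', (ω, v))`, whence of
parameters, by Fubini) or satisfy it, in which case their `u`-sections are null.
[cite: BodineauGallagherSaintRaymondInvent2016, §5.1 p. 15] -/
theorem gainPullback (hd : 2 ≤ Fintype.card d) : GainPullback (d := d) ε := by
  classical
  intro s i
  cases s with
  | zero => exact i.elim0
  | succ m =>
  haveI hσf : IsFiniteMeasure (sphereMeasure (E := EuclideanSpace ℝ d)) :=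
    Literature.Analysis.FluidPDE.isFiniteMeasure_sphereMeasure (E := EuclideanSpace ℝ d)
  set μQ : Measure (sphere (0 : EuclideanSpace ℝ d) 1 × EuclideanSpace ℝ d) :=
    (sphereMeasure (E := EuclideanSpace ℝ d)).prod volume with hμQ
  haveI : SFinite μQ := by rw [hμQ]; infer_instance
  set μP : Measure ((ℝ × Config (m + 1) d (UnitAddTorus d)) × (sphere (0 : EuclideanSpace ℝ d) 1 × EuclideanSpace ℝ d)) :=
    ((volume : Measure ℝ).prod (volume : Measure (Config (m + 1) d (UnitAddTorus d)))).prod μQ with hμP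
  -- the map and its measurability
  have hGm := Literature.Analysis.FluidPDE.Torus.isMeasurable_geometry (d := d)
  have hgain : Measurable fun p : (ℝ × Config (m + 1) d (UnitAddTorus d)) ×
      (sphere (0 : EuclideanSpace ℝ d) 1 × EuclideanSpace ℝ d) => gainConfig (Literature.Analysis.FluidPDE.Torus.geometry d) ε p.1.2 i p.2.1 p.2.2 :=
    Literature.Analysis.FluidPDE.measurable_gainConfig hGm.measurable_translate ε i measurable_fst.snd
      (continuous_subtype_val.measurable.comp measurable_snd.fst) measurable_snd.snd
  have hloss : Measurable fun p : (ℝ × Config (m + 1) d (UnitAddTorus d)) ×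
      (sphere (0 : EuclideanSpace ℝ d) 1 × EuclideanSpace ℝ d) => lossConfig (Literature.Analysis.FluidPDE.Torus.geometry d) ε p.1.2 i p.2.1 p.2.2 :=
    Literature.Analysis.FluidPDE.measurable_lossConfig hGm.measurable_translate ε i measurable_fst.snd
      (continuous_subtype_val.measurable.comp measurable_snd.fst) measurable_snd.snd
  have hpair : Measurable fun p : (ℝ × Config (m + 1) d (UnitAddTorus d)) ×
      (sphere (0 : EuclideanSpace ℝ d) 1 × EuclideanSpace ℝ d) =>
      ((-p.1.1, outRep (Literature.Analysis.FluidPDE.Torus.geometry d) (m + 1) i (gainConfig (Literature.Analysis.FluidPDE.Torus.geometry d) ε p.1.2 i p.2.1 p.2.2)) : ℝ × Config (m + 1 + 1) d (UnitAddTorus d)) :=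
    measurable_fst.fst.neg.prodMk ((measurable_outRep hGm (m + 1) i).comp hgain)
  have hΛ : Measurable fun p : (ℝ × Config (m + 1) d (UnitAddTorus d)) ×
      (sphere (0 : EuclideanSpace ℝ d) 1 × EuclideanSpace ℝ d) =>
      Literature.Analysis.FluidPDE.Alexander.regFlow (Literature.Analysis.FluidPDE.Torus.geometry d) ε (-p.1.1) (outRep (Literature.Analysis.FluidPDE.Torus.geometry d) (m + 1) i (gainConfig (Literature.Analysis.FluidPDE.Torus.geometry d) ε p.1.2 i p.2.1 p.2.2)) := by
    have h := (Literature.Analysis.FluidPDE.Alexander.measurable_regFlow_uncurry (d := d) (N := m + 1 + 1) hε').comp hpair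
    exact h
  refine ⟨hΛ, Measure.AbsolutelyContinuous.mk fun A hA hA0 => ?_⟩
  rw [Measure.map_apply hΛ hA, Measure.restrict_apply (hΛ hA)]
  have hSm := measurableSet_gainParams (d := d) (ε := ε) (m + 1) i
  -- the engine statement, as a product-a.e. statement on `Config × (S × ℝ^d)`
  set M : Set (Config (m + 1) d (UnitAddTorus d) × (sphere (0 : EuclideanSpace ℝ d) 1 × EuclideanSpace ℝ d)) :=
    {x | 0 < ⟪x.2.2 - (x.1 i).2, (x.2.1 : EuclideanSpace ℝ d)⟫_ℝ →
      lossConfig (Literature.Analysis.FluidPDE.Torus.geometry d) ε x.1 i x.2.1 x.2.2 ∈ hardSphereDomain (Literature.Analysis.FluidPDE.Torus.geometry d) (m + 1 + 1) ε →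
      (lossConfig (Literature.Analysis.FluidPDE.Torus.geometry d) ε x.1 i x.2.1 x.2.2 ∈ Literature.Analysis.FluidPDE.Alexander.good (N := m + 1 + 1) (Literature.Analysis.FluidPDE.Torus.geometry d) ε ∧
        ∀ᵐ u : ℝ, ¬ (0 < u ∧ Literature.Analysis.FluidPDE.Alexander.regFlow (Literature.Analysis.FluidPDE.Torus.geometry d) ε (-u)
          (lossConfig (Literature.Analysis.FluidPDE.Torus.geometry d) ε x.1 i x.2.1 x.2.2) ∈ A))} with hM
  have hMm : MeasurableSet M := by
    have hflux : Measurable fun x : Config (m + 1) d (UnitAddTorus d) ×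
        (sphere (0 : EuclideanSpace ℝ d) 1 × EuclideanSpace ℝ d) => ⟪x.2.2 - (x.1 i).2, (x.2.1 : EuclideanSpace ℝ d)⟫_ℝ :=
      (measurable_snd.snd.sub ((measurable_pi_apply i).comp measurable_fst).snd).inner
        (continuous_subtype_val.measurable.comp measurable_snd.fst)
    have hl : Measurable fun x : Config (m + 1) d (UnitAddTorus d) ×
        (sphere (0 : EuclideanSpace ℝ d) 1 × EuclideanSpace ℝ d) => lossConfig (Literature.Analysis.FluidPDE.Torus.geometry d) ε x.1 i x.2.1 x.2.2 :=
      Literature.Analysis.FluidPDE.measurable_lossConfig hGm.measurable_translate ε i measurable_fst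
        (continuous_subtype_val.measurable.comp measurable_snd.fst) measurable_snd.snd
    exact measurableSet_imp (measurableSet_lt measurable_const hflux)
      (measurableSet_imp ((measurableSet_hardSphereDomain_torus (m + 1 + 1) ε).preimage hl)
        ((measurableSet_goodAvoids hε hε' hA).preimage hl))
  have hE := ae_lossConfig_goodAvoids hε hε' hd i hA hA0
  have hB1 : ∀ᵐ Z' : Config (m + 1) d (UnitAddTorus d), ∀ᵐ q ∂μQ, (Z', q) ∈ M := by
    filter_upwards [hE] with Z' hZ'
    have hmeas : MeasurableSet {y : EuclideanSpace ℝ d × sphere (0 : EuclideanSpace ℝ d) 1 | (Z', (y.2, y.1)) ∈ M} :=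
      hMm.preimage (measurable_const.prodMk (measurable_snd.prodMk measurable_fst))
    have h1 := (Measure.ae_ae_comm (μ := (volume : Measure (EuclideanSpace ℝ d))) (ν := sphereMeasure (E := EuclideanSpace ℝ d))
      (p := fun (w : EuclideanSpace ℝ d) (ν : sphere (0 : EuclideanSpace ℝ d) 1) => (Z', (ν, w)) ∈ M) hmeas).1 hZ'
    have hmeas' : MeasurableSet {q : sphere (0 : EuclideanSpace ℝ d) 1 × EuclideanSpace ℝ d | (Z', q) ∈ M} :=
      hMm.preimage (measurable_const.prodMk measurable_id)
    exact (Measure.ae_prod_iff_ae_ae (μ := sphereMeasure (E := EuclideanSpace ℝ d)) (ν := (volume : Measure (EuclideanSpace ℝ d)))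
      hmeas').2 h1
  have hprod : ∀ᵐ x ∂((volume : Measure (Config (m + 1) d (UnitAddTorus d))).prod μQ), x ∈ M :=
    (Measure.ae_prod_iff_ae_ae hMm).2 hB1
  -- pulled back to the parameters (dropping the time)
  have hπ : QuasiMeasurePreserving
      (fun p : (ℝ × Config (m + 1) d (UnitAddTorus d)) × (sphere (0 : EuclideanSpace ℝ d) 1 × EuclideanSpace ℝ d) =>
        ((p.1.2, p.2) : Config (m + 1) d (UnitAddTorus d) × (sphere (0 : EuclideanSpace ℝ d) 1 × EuclideanSpace ℝ d)))
      μP ((volume : Measure (Config (m + 1) d (UnitAddTorus d))).prod μQ) :=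
    QuasiMeasurePreserving.prodMap
      (quasiMeasurePreserving_snd (μ := (volume : Measure ℝ)) (ν := (volume : Measure (Config (m + 1) d (UnitAddTorus d)))))
      (QuasiMeasurePreserving.id μQ)
  have hM' : ∀ᵐ p ∂μP, (p.1.2, p.2) ∈ M := hπ.ae hprod
  -- the parameters satisfying the engine property: null time sections
  set E₂ : Set ((ℝ × Config (m + 1) d (UnitAddTorus d)) × (sphere (0 : EuclideanSpace ℝ d) 1 × EuclideanSpace ℝ d)) :=
    {p | (p.1.2, p.2) ∈ M ∧ p ∈ (fun p : (ℝ × Config (m + 1) d (UnitAddTorus d)) ×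
        (sphere (0 : EuclideanSpace ℝ d) 1 × EuclideanSpace ℝ d) =>
        Literature.Analysis.FluidPDE.Alexander.regFlow (Literature.Analysis.FluidPDE.Torus.geometry d) ε (-p.1.1)
          (outRep (Literature.Analysis.FluidPDE.Torus.geometry d) (m + 1) i (gainConfig (Literature.Analysis.FluidPDE.Torus.geometry d) ε p.1.2 i p.2.1 p.2.2))) ⁻¹' A ∩
      {p | 0 < p.1.1 ∧ 0 < ⟪(p.2.1 : EuclideanSpace ℝ d), p.2.2 - (p.1.2 i).2⟫_ℝ ∧
        gainConfig (Literature.Analysis.FluidPDE.Torus.geometry d) ε p.1.2 i p.2.1 p.2.2 ∈ hardSphereDomain (Literature.Analysis.FluidPDE.Torus.geometry d) (m + 1 + 1) ε}} with hE₂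
  have hE₂m : MeasurableSet E₂ :=
    (hMm.preimage (measurable_fst.snd.prodMk measurable_snd)).inter ((hΛ hA).inter hSm)
  have hsec : ∀ (q : sphere (0 : EuclideanSpace ℝ d) 1 × EuclideanSpace ℝ d) (Y : Config (m + 1) d (UnitAddTorus d)),
      (volume : Measure ℝ) {u : ℝ | ((u, Y), q) ∈ E₂} = 0 := by
    intro q Y
    by_cases hc : 0 < ⟪(q.1 : EuclideanSpace ℝ d), q.2 - (Y i).2⟫_ℝ ∧
        gainConfig (Literature.Analysis.FluidPDE.Torus.geometry d) ε Y i q.1 q.2 ∈ hardSphereDomain (Literature.Analysis.FluidPDE.Torus.geometry d) (m + 1 + 1) ε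
    · by_cases hm : (Y, q) ∈ M
      · have hflux : 0 < ⟪q.2 - (Y i).2, (q.1 : EuclideanSpace ℝ d)⟫_ℝ := by rw [real_inner_comm]; exact hc.1
        have hdom : lossConfig (Literature.Analysis.FluidPDE.Torus.geometry d) ε Y i q.1 q.2 ∈ hardSphereDomain (Literature.Analysis.FluidPDE.Torus.geometry d) (m + 1 + 1) ε :=
          (gainConfig_mem_hardSphereDomain_iff hε hε' Y i q.1 q.2).1 hc.2
        obtain ⟨-, havoid⟩ := hm hflux hdom
        refine measure_mono_null (fun u hu => ?_) (ae_iff.1 havoid)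
        obtain ⟨-, huA, hu0, -, -⟩ := hu
        rw [mem_preimage, outRep_gainConfig_torus hε hε'] at huA
        exact fun h => h ⟨hu0, huA⟩
      · refine measure_mono_null (fun u hu => ?_) (measure_empty (μ := (volume : Measure ℝ)))
        exact (hm hu.1).elim
    · refine measure_mono_null (fun u hu => ?_) (measure_empty (μ := (volume : Measure ℝ)))
      exact (hc hu.2.2.2).elim
  have hE₂0 : μP E₂ = 0 := by
    rw [hμP, Measure.prod_apply_symm hE₂m]
    have hq : ∀ q : sphere (0 : EuclideanSpace ℝ d) 1 × EuclideanSpace ℝ d,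
        ((volume : Measure ℝ).prod (volume : Measure (Config (m + 1) d (UnitAddTorus d))))
          ((fun y => (y, q)) ⁻¹' E₂) = 0 := by
      intro q
      rw [Measure.prod_apply_symm (hE₂m.preimage measurable_prodMk_right)]
      have hY : ∀ Y : Config (m + 1) d (UnitAddTorus d),
          (volume : Measure ℝ) ((fun u : ℝ => (u, Y)) ⁻¹' ((fun y => (y, q)) ⁻¹' E₂)) = 0 := fun Y => hsec q Y
      simp [hY]
    simp [hq]
  -- conclusion
  refine measure_mono_null (fun p hp => ?_) (measure_union_null (ae_iff.1 hM') hE₂0)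
  by_cases hm : (p.1.2, p.2) ∈ M
  · exact Or.inr ⟨hm, hp⟩
  · exact Or.inl hm

/-! ## §4. `LossPullback` holds -/

include hε hε' in
/-- **The transported loss adjunctions pull Lebesgue-null sets back to null sets**
(`LossPullback ε`, `d ≥ 2`, `0 < ε < 1/2`): `outRep (lossConfig Z' i ω v) = gainConfig Z' i ω v`
is the loss configuration of the scattered parameters `(Z'', v*)`
(`gainConfig_eq_lossConfig_scatterParams`), i.e. the loss adjunction map is the gain adjunction
map composed with the scattering `((u, Z'), (ω, v)) ↦ ((u, Z''), (ω, v*))`, which preserves the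
parameter measure (`measurePreserving_scatterSkew`) and exchanges the two parameter sets
(`inner_scatterParams`). [cite: BodineauGallagherSaintRaymondInvent2016, §5.1 p. 15] -/
theorem lossPullback (hd : 2 ≤ Fintype.card d) : LossPullback (d := d) ε := by
  classical
  intro s i
  cases s with
  | zero => exact i.elim0
  | succ m =>
  haveI hσf : IsFiniteMeasure (sphereMeasure (E := EuclideanSpace ℝ d)) :=
    Literature.Analysis.FluidPDE.isFiniteMeasure_sphereMeasure (E := EuclideanSpace ℝ d)
  set μQ : Measure (sphere (0 : EuclideanSpace ℝ d) 1 × EuclideanSpace ℝ d) :=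
    (sphereMeasure (E := EuclideanSpace ℝ d)).prod volume with hμQ
  haveI : SFinite μQ := by rw [hμQ]; infer_instance
  set μP : Measure ((ℝ × Config (m + 1) d (UnitAddTorus d)) × (sphere (0 : EuclideanSpace ℝ d) 1 × EuclideanSpace ℝ d)) :=
    ((volume : Measure ℝ).prod (volume : Measure (Config (m + 1) d (UnitAddTorus d)))).prod μQ with hμP
  have hGP := gainPullback hε hε' hd (m + 1) i
  -- the scattering of the parameters, with the time carried along
  set Ξ : (ℝ × Config (m + 1) d (UnitAddTorus d)) × (sphere (0 : EuclideanSpace ℝ d) 1 × EuclideanSpace ℝ d) →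
      (ℝ × Config (m + 1) d (UnitAddTorus d)) × (sphere (0 : EuclideanSpace ℝ d) 1 × EuclideanSpace ℝ d) := fun p =>
    ((p.1.1, (scatterParams i p.2.1 (p.1.2, p.2.2)).1), (p.2.1, (scatterParams i p.2.1 (p.1.2, p.2.2)).2)) with hΞ
  have hΞmp : MeasurePreserving Ξ μP μP := by
    have hsk := measurePreserving_scatterSkew (d := d) i
    have h1 : MeasurePreserving
        (Prod.map (id : ℝ → ℝ) (fun x : Config (m + 1) d (UnitAddTorus d) × (sphere (0 : EuclideanSpace ℝ d) 1 × EuclideanSpace ℝ d) =>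
          ((scatterParams i x.2.1 (x.1, x.2.2)).1, (x.2.1, (scatterParams i x.2.1 (x.1, x.2.2)).2))))
        ((volume : Measure ℝ).prod ((volume : Measure (Config (m + 1) d (UnitAddTorus d))).prod μQ))
        ((volume : Measure ℝ).prod ((volume : Measure (Config (m + 1) d (UnitAddTorus d))).prod μQ)) :=
      (MeasurePreserving.id (volume : Measure ℝ)).prod hsk
    have hA := measurePreserving_prodAssoc (volume : Measure ℝ) (volume : Measure (Config (m + 1) d (UnitAddTorus d))) μQ
    have key := (hA.symm _).comp (h1.comp hA)
    have hfun : (MeasurableEquiv.prodAssoc.symm ∘ Prod.map (id : ℝ → ℝ)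
        (fun x : Config (m + 1) d (UnitAddTorus d) × (sphere (0 : EuclideanSpace ℝ d) 1 × EuclideanSpace ℝ d) =>
          ((scatterParams i x.2.1 (x.1, x.2.2)).1, (x.2.1, (scatterParams i x.2.1 (x.1, x.2.2)).2))) ∘
        (MeasurableEquiv.prodAssoc :
          (ℝ × Config (m + 1) d (UnitAddTorus d)) × (sphere (0 : EuclideanSpace ℝ d) 1 × EuclideanSpace ℝ d) ≃ᵐ
            ℝ × (Config (m + 1) d (UnitAddTorus d) × (sphere (0 : EuclideanSpace ℝ d) 1 × EuclideanSpace ℝ d)))) = Ξ := by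
      funext p
      rfl
    rw [hfun] at key
    exact key
  -- it exchanges the two parameter sets
  have hSg := measurableSet_gainParams (d := d) (ε := ε) (m + 1) i
  have hpre : Ξ ⁻¹' {p : (ℝ × Config (m + 1) d (UnitAddTorus d)) × (sphere (0 : EuclideanSpace ℝ d) 1 × EuclideanSpace ℝ d) |
        0 < p.1.1 ∧ 0 < ⟪(p.2.1 : EuclideanSpace ℝ d), p.2.2 - (p.1.2 i).2⟫_ℝ ∧
          gainConfig (Literature.Analysis.FluidPDE.Torus.geometry d) ε p.1.2 i p.2.1 p.2.2 ∈ hardSphereDomain (Literature.Analysis.FluidPDE.Torus.geometry d) (m + 1 + 1) ε} =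
      {p | 0 < p.1.1 ∧ ⟪(p.2.1 : EuclideanSpace ℝ d), p.2.2 - (p.1.2 i).2⟫_ℝ < 0 ∧
          lossConfig (Literature.Analysis.FluidPDE.Torus.geometry d) ε p.1.2 i p.2.1 p.2.2 ∈ hardSphereDomain (Literature.Analysis.FluidPDE.Torus.geometry d) (m + 1 + 1) ε} := by
    ext p
    simp only [mem_preimage, mem_setOf_eq, hΞ]
    have hinner : ⟪(p.2.1 : EuclideanSpace ℝ d), (scatterParams i p.2.1 (p.1.2, p.2.2)).2 -
        ((scatterParams i p.2.1 (p.1.2, p.2.2)).1 i).2⟫_ℝ = -⟪(p.2.1 : EuclideanSpace ℝ d), p.2.2 - (p.1.2 i).2⟫_ℝ := by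
      rw [real_inner_comm, inner_scatterParams, real_inner_comm]
    have hdom : gainConfig (Literature.Analysis.FluidPDE.Torus.geometry d) ε (scatterParams i p.2.1 (p.1.2, p.2.2)).1 i p.2.1 (scatterParams i p.2.1 (p.1.2, p.2.2)).2 ∈
          hardSphereDomain (Literature.Analysis.FluidPDE.Torus.geometry d) (m + 1 + 1) ε ↔
        lossConfig (Literature.Analysis.FluidPDE.Torus.geometry d) ε p.1.2 i p.2.1 p.2.2 ∈ hardSphereDomain (Literature.Analysis.FluidPDE.Torus.geometry d) (m + 1 + 1) ε := by
      rw [gainConfig_mem_hardSphereDomain_iff hε hε', ← gainConfig_eq_lossConfig_scatterParams,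
        gainConfig_mem_hardSphereDomain_iff hε hε']
    rw [hinner, hdom]
    constructor
    · rintro ⟨h1, h2, h3⟩; exact ⟨h1, by linarith, h3⟩
    · rintro ⟨h1, h2, h3⟩; exact ⟨h1, by linarith, h3⟩
  have hΞr := hΞmp.restrict_preimage hSg
  rw [hpre] at hΞr
  have hcomp := hGP.comp hΞr.quasiMeasurePreserving
  have hfun : ((fun p : (ℝ × Config (m + 1) d (UnitAddTorus d)) × (sphere (0 : EuclideanSpace ℝ d) 1 × EuclideanSpace ℝ d) =>
      Literature.Analysis.FluidPDE.Alexander.regFlow (Literature.Analysis.FluidPDE.Torus.geometry d) ε (-p.1.1) (outRep (Literature.Analysis.FluidPDE.Torus.geometry d) (m + 1) i (gainConfig (Literature.Analysis.FluidPDE.Torus.geometry d) ε p.1.2 i p.2.1 p.2.2))) ∘ Ξ) =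
      fun p => Literature.Analysis.FluidPDE.Alexander.regFlow (Literature.Analysis.FluidPDE.Torus.geometry d) ε (-p.1.1)
        (outRep (Literature.Analysis.FluidPDE.Torus.geometry d) (m + 1) i (lossConfig (Literature.Analysis.FluidPDE.Torus.geometry d) ε p.1.2 i p.2.1 p.2.2)) := by
    funext p
    simp only [Function.comp_apply, hΞ]
    rw [outRep_gainConfig_torus hε hε', outRep_lossConfig_torus hε hε', ← gainConfig_eq_lossConfig_scatterParams]
  rw [hfun] at hcomp
  exact hcomp

/-! ## §5. The corrected input (R) -/

/-- **The hard-sphere hierarchy on `T^d` respects Lebesgue-null sets on domain-supported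
families** (the corrected input (R) of the BGSR programme, `HierarchyModel.RespectsAEOn` of
`HierarchyDuhamelSeriesOn`): for `d ≥ 2`, `0 < ε < 1/2` and every particle number `N`, two nice
families supported in the hard-sphere domains and equal Lebesgue-a.e. at every level have
Lebesgue-a.e. equal Duhamel terms (`hs_respectsAEOn_of_pullback` with `gainPullback`,
`lossPullback`). BGSR Remark 3.1 / p. 15 (after Simonella 2014): the parametrisation of the
pseudo-trajectories is non-singular. [cite: BodineauGallagherSaintRaymondInvent2016, §3.1 Remark 3.1 p. 9 and §5.1 p. 15] -/
theorem hsHierarchyModel_respectsAEOn (hd : 2 ≤ Fintype.card d) (N : ℕ) :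
    (hsHierarchyModel (d := d) hε hε' N).RespectsAEOn (fun _ => volume)
      (fun k => hardSphereDomain (Literature.Analysis.FluidPDE.Torus.geometry d) k ε) :=
  hs_respectsAEOn_of_pullback hε hε' N (gainPullback hε hε' hd) (lossPullback hε hε' hd)

omit [Fintype d] in
/-- **The corrected input (R) of `bgsr_linearBoltzmannApprox_of_domainInputs`, discharged**
(binder for binder its hypothesis `hRob`). [cite: BodineauGallagherSaintRaymondInvent2016, §3.1 Remark 3.1 p. 9 and §5.1 p. 15] -/
theorem hsHierarchyModel_respectsAEOn_all [Fintype d] :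
    2 ≤ Fintype.card d → ∀ (Ntot : ℕ) (ε : ℝ) (hε : 0 < ε) (hε' : ε < 2⁻¹),
      (hsHierarchyModel (d := d) hε hε' Ntot).RespectsAEOn (fun _ => volume)
        (fun k => hardSphereDomain (Literature.Analysis.FluidPDE.Torus.geometry d) k ε) :=
  fun hd Ntot _ hε hε' => hsHierarchyModel_respectsAEOn hε hε' hd Ntot

end Kinetic

end

end Literature.MathematicalPhysics.KineticTheory
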